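import Literature.Probability.Percolation.MarkedLoopBoundarySupport
import Literature.Probability.Percolation.MarkedLoopLinkPatternLaw
import HarnessLib

/-!
# Boundary support of the link-pattern law, COUNT form: `N_j(z) = 0` for the inadmissible partners, and the admissible ones carry all the mass

Topic `Literature/Probability/Percolation`; generic-`k` layer. The class-emptiness theorem `not_inClassX_of_odd_gap'` of
`MarkedLoopBoundarySupport.lean` read through the counts `classCountK` / `HobsK` of `MarkedLoopLinkPatternLaw.lean`: for a `k`-marked
domain with `k` odd and a boundary mid-edge `z` of the arc `A_a` read at a face with three `H_G`-sides,

* `classCountK_eq_zero_of_odd_gap`, `hobsK_eq_zero_of_odd_gap` — `N_j(z) = 0`, `H_j(z) = 0` whenever the number of corners strictly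
  between the arc and `u_j` is odd (partners `u_{a+2}, u_{a+4}, …` excluded);
* `sum_hobsK_admissible_eq_one` — the `(k+1)/2` admissible partners `u_{a+1}, u_{a+3}, …, u_a` carry all the mass:
  `Σ_{j : gapIdx a j even} H_j(z) = 1` (the generic boundary simplex; `k = 3`: `H_a + H_{a+1} = 1`, eq. (4); `k = 5`: the partner
  marginal of the lane's five-term boundary simplex).

## References
* M. Khristoforov, S. Smirnov, *Percolation and O(1) loop model*, arXiv:2111.15612 (2021), §1.2 (arXiv v1 p. 2), §2 eq. (4) (p. 5).
* B. Bollobás, O. Riordan, *Percolation*, CUP (2006), Ch. 7 §7.2.2 (pp. 191–195).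
-/

open Finset

namespace Literature.Probability.Percolation.MarkedLoops

open Literature.Probability.Percolation Literature.Probability.LatticeModels
open Literature.Probability.Percolation.FivePoint (side tau xiDeg XiLinked)
open TriMarkedDomain

section SupportCount

variable {nm : ℕ} {D : TriMarkedDomain nm}

/-- ★ **`N_j(z) = 0` for an inadmissible partner** (odd gap), both halves of the subdivided edge. [cite: KhristoforovSmirnov2021, §1.2 (arXiv v1 p. 2) and §2 eq. (4) (p. 5)] -/
theorem classCountK_eq_zero_of_odd_gap (hodd : Odd nm) {v : HexVertex} (hv : AllSides D v) {i : Fin 3} {g o : Site 2}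
    (he : side v i = s(g, o)) {a : Fin nm} (hd : (g, o) ∈ D.stretch a) {j : Fin nm} (hgap : Odd (gapIdx nm a j)) :
    classCountK D v i j = 0 := by
  classical
  unfold classCountK
  rw [Nat.add_eq_zero_iff, Finset.card_eq_zero, Finset.card_eq_zero, Finset.filter_eq_empty_iff, Finset.filter_eq_empty_iff]
  exact ⟨fun ξ hξ => not_inClassX_of_odd_gap' hodd hv (s := v) (by simp) he hd hgap hξ,
    fun ξ hξ => not_inClassX_of_odd_gap' hodd hv (s := oppFace v i) (by simp) he hd hgap hξ⟩

/-- ★ **`H_j(z) = 0` for an inadmissible partner.** [cite: KhristoforovSmirnov2021, §1.2 (arXiv v1 p. 2) and §2 eq. (4) (p. 5)] -/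
theorem hobsK_eq_zero_of_odd_gap (hodd : Odd nm) {v : HexVertex} (hv : AllSides D v) {i : Fin 3} {g o : Site 2}
    (he : side v i = s(g, o)) {a : Fin nm} (hd : (g, o) ∈ D.stretch a) {j : Fin nm} (hgap : Odd (gapIdx nm a j)) :
    HobsK D v i j = 0 := by
  unfold HobsK
  rw [classCountK_eq_zero_of_odd_gap hodd hv he hd hgap, Nat.cast_zero, zero_div]

/-- ★★ **THE GENERIC BOUNDARY SIMPLEX**: on the arc `A_a` the admissible partners (even gap: `u_{a+1}, u_{a+3}, …, u_a`) carry all the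
mass, `Σ_{j : gap even} H_j(z) = 1`. [cite: KhristoforovSmirnov2021, §1.2 (arXiv v1 p. 2) and §2 eq. (4) (p. 5)] -/
theorem sum_hobsK_admissible_eq_one (hodd : Odd nm) {v : HexVertex} (hv : AllSides D v) {i : Fin 3} {g o : Site 2}
    (he : side v i = s(g, o)) {a : Fin nm} (hd : (g, o) ∈ D.stretch a) :
    ∑ j ∈ (Finset.univ : Finset (Fin nm)).filter (fun j => Even (gapIdx nm a j)), HobsK D v i j = 1 := by
  classical
  rw [← sum_hobsK_eq_one D hodd hv i, ← Finset.sum_filter_add_sum_filter_not Finset.univ (fun j => Even (gapIdx nm a j))]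
  have h0 : ∑ j ∈ (Finset.univ : Finset (Fin nm)).filter (fun j => ¬ Even (gapIdx nm a j)), HobsK D v i j = 0 :=
    Finset.sum_eq_zero fun j hj => by
      rw [Finset.mem_filter] at hj
      exact hobsK_eq_zero_of_odd_gap hodd hv he hd (Nat.not_even_iff_odd.1 hj.2)
  rw [h0, add_zero]

end SupportCount

end Literature.Probability.Percolation.MarkedLoops
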